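import Literature.AlgebraicGeometry.Motives.AbelianVarietyFrobeniusTwistPoints
import Literature.AlgebraicGeometry.Motives.AbelianVarietyProjective
import HarnessLib

/-!
# Base change of integral models along a compatible square `R → R′`, `K → K′` (bookkeeping for descent)

Topic `Literature/AlgebraicGeometry/Motives`; namespace `Literature.AlgebraicGeometry.Motives.IntegralModel`.
Definitions WITH BODIES + theorems; NO named fact, no instance, no notation (net Literature debt 0).  Cell `hodgecm-mathlib`
(D-0151), fan B-III (T1) road W for `r₀`, piece (W4b) «base-change bookkeeping» of the descent stub
`stub_W4_koizumi_descends` of `Cruxes/H21/Lines/r0_koizumi.lean` (B-plan1): Koizumi's theorem over a strictly local cover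
`R′/R` is obtained for the BASE-CHANGED model `𝒳 ⊗_R R′` of the BASE-CHANGED abelian variety `A ⊗_K K′` (`K′ = Frac R′`), and
is then descended along `R → R′` (fpqc descent of the structure morphisms, (W4)).  This file supplies the first half: for a
square of ring maps

  `R  → K`
  `↓    ↓`      with `(R′ → K′) ∘ (R → R′) = (K → K′) ∘ (R → K)` (the two `IsScalarTower` instances),
  `R′ → K′`

and an integral model `𝒳` of a `K`-scheme `X` over `R` (`IntegralModel R K X`: a total space `𝒳 → Spec R` with
`genericIso : 𝒳 ⊗_R K ≅ X`), the integral model `𝒳 ⊗_R R′` of `X ⊗_K K′` over `R′` whose generic isomorphism is the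
composite of the exchange isomorphism `(𝒳 ⊗_R R′) ⊗_{R′} K′ ≅ (𝒳 ⊗_R K) ⊗_K K′` (transitivity of base change,
[GortzWedhorn2020] Prop. 4.16 / §(4.7), the tree's `baseChangeHomCommIso`) with `genericIso ⊗_K K′`
([BLR1990] §1.2, base change of models; [SerreTate1968] §1).  What is here:

* `IntegralModel.baseChangeGenericNatIso R′ K′` — the exchange isomorphism of functors
  `(− ⊗_R R′) ⊗_{R′} K′ ≅ (− ⊗_R K) ⊗_K K′` on `R`-schemes, from the square;
* `IntegralModel.baseChange 𝒳 R′ K′ : IntegralModel R′ K′ ((baseChange K K′).obj X)` — total space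
  `(baseChange R R′).obj 𝒳.total`; for an abelian variety this is a model of `(A.baseChange K′).X` on the nose
  (`IntegralModel.baseChangeAbelianVariety`, `AbelianVariety.baseChange_X` is `rfl`);
* `IsSmoothProper.baseChange` — smooth of relative dimension `n` and proper are preserved (Mathlib's
  `IsStableUnderBaseChange` instances), with the abelian-variety reading at `n = dim A = dim A_{K′}`;
* the projection formulas pinning the new generic isomorphism for descent arguments:
  `baseChangeGenericNatIso_hom_app_left_comp_fst_fst` (the exchange iso commutes with the double first projections to
  `𝒳`), `baseChange_genericIso_hom_left_comp_fst` (`genericIso′ ≫ pr = exch ≫ pr ≫ genericIso` on underlying schemes)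
  and their combination `baseChange_genericIso_hom_left_comp_fst_comp`.

Kernel hygiene (cell lessons «F6» / Q5): the functor isomorphisms are never unfolded by `rfl` against hand-written
composites; every projection law is a rewrite with the tree's `baseChangeHomCommIso_hom_app_left_comp_fst_fst` /
`baseChangeHom_map_left_comp_fst`.  HC_CM is proved only modulo the 7 printed citations until rung 0 closes.

## References
* [BLR1990] S. Bosch, W. Lütkebohmert, M. Raynaud, *Néron Models*, Springer 1990, §1.2 (models and base change), §6.5
  (descent).
* [GortzWedhorn2020] U. Görtz, T. Wedhorn, *Algebraic Geometry I*, 2nd ed. 2020, Prop. 4.16 and §(4.7) (transitivity of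
  base change), Remark 16.54.
* [SerreTate1968] J.-P. Serre, J. Tate, *Good reduction of abelian varieties*, Ann. of Math. 88 (1968), §1.
-/

set_option autoImplicit false

noncomputable section

-- compositions through `((Over.pullback f).obj X).left` are definitional only above `instances` transparency
set_option backward.isDefEq.respectTransparency false

open CategoryTheory CategoryTheory.Limits AlgebraicGeometry

universe u

namespace Literature.AlgebraicGeometry.Motives

namespace IntegralModel

variable {R K : Type u} [CommRing R] [Field K] [Algebra R K]
  (R' K' : Type u) [CommRing R'] [Field K'] [Algebra R R'] [Algebra R' K'] [Algebra K K'] [Algebra R K']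
  [IsScalarTower R R' K'] [IsScalarTower R K K']

/-- The square of ring maps commutes: `(R′ → K′) ∘ (R → R′) = (K → K′) ∘ (R → K)` (both are `R → K′`).
[cite: GortzWedhorn2020, Prop. 4.16 and §(4.7)] -/
theorem algebraMap_comp_algebraMap_eq :
    (algebraMap R' K').comp (algebraMap R R') = (algebraMap K K').comp (algebraMap R K) := by
  rw [← IsScalarTower.algebraMap_eq R R' K', ← IsScalarTower.algebraMap_eq R K K']

/-- **The exchange isomorphism `(− ⊗_R R′) ⊗_{R′} K′ ≅ (− ⊗_R K) ⊗_K K′`** of functors on `R`-schemes, for the commuting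
square `R → R′ → K′`, `R → K → K′` (transitivity of base change twice; the tree's `baseChangeHomCommIso`).
[cite: GortzWedhorn2020, Prop. 4.16 and §(4.7)] -/
def baseChangeGenericNatIso :
    baseChangeHom (algebraMap R R') ⋙ baseChangeHom (algebraMap R' K') ≅
      baseChangeHom (algebraMap R K) ⋙ baseChangeHom (algebraMap K K') :=
  baseChangeHomCommIso (algebraMap R R') (algebraMap R' K') (algebraMap R K) (algebraMap K K')
    (algebraMap_comp_algebraMap_eq R' K')

/-- The exchange isomorphism commutes with the double first projections to the `R`-scheme:
`exch_𝒴 ≫ pr ≫ pr = pr ≫ pr` on underlying schemes. [cite: GortzWedhorn2020, Prop. 4.16 and §(4.7)] -/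
@[reassoc]
theorem baseChangeGenericNatIso_hom_app_left_comp_fst_fst (𝒴 : SchemeOver R) :
    ((baseChangeGenericNatIso R' K').hom.app 𝒴).left ≫
        baseChangeHomFst (algebraMap K K') ((baseChangeHom (algebraMap R K)).obj 𝒴) ≫
          baseChangeHomFst (algebraMap R K) 𝒴 =
      baseChangeHomFst (algebraMap R' K') ((baseChangeHom (algebraMap R R')).obj 𝒴) ≫
        baseChangeHomFst (algebraMap R R') 𝒴 := by
  rw [baseChangeGenericNatIso]
  exact baseChangeHomCommIso_hom_app_left_comp_fst_fst _ _ _ _ _ 𝒴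

variable {X : SchemeOver K} (𝒳 : IntegralModel R K X)

/-- **Base change of an integral model along the square `R → R′`, `K → K′`**: the `R′`-scheme `𝒳 ⊗_R R′` with generic
isomorphism `(𝒳 ⊗_R R′) ⊗_{R′} K′ ≅ (𝒳 ⊗_R K) ⊗_K K′ ≅ X ⊗_K K′` — an integral model of `X ⊗_K K′` over `R′`
([BLR1990] §1.2; [SerreTate1968] §1). [cite: SerreTate1968, §1] [cite: GortzWedhorn2020, Prop. 4.16 and §(4.7)] -/
def baseChange : IntegralModel R' K' ((Literature.AlgebraicGeometry.Motives.baseChange K K').obj X) where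
  total := (Literature.AlgebraicGeometry.Motives.baseChange R R').obj 𝒳.total
  genericIso := (baseChangeGenericNatIso R' K').app 𝒳.total ≪≫
    (Literature.AlgebraicGeometry.Motives.baseChange K K').mapIso 𝒳.genericIso

/-- The total space of the base-changed model is `𝒳 ⊗_R R′` (by `rfl`). [cite: SerreTate1968, §1] -/
@[simp] theorem baseChange_total :
    (𝒳.baseChange R' K').total = (Literature.AlgebraicGeometry.Motives.baseChange R R').obj 𝒳.total := rfl

/-- Unfolding the generic isomorphism of the base-changed model: exchange isomorphism, then `genericIso ⊗_K K′`.
[cite: GortzWedhorn2020, Prop. 4.16 and §(4.7)] -/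
theorem baseChange_genericIso_hom :
    (𝒳.baseChange R' K').genericIso.hom =
      (baseChangeGenericNatIso R' K').hom.app 𝒳.total ≫
        (Literature.AlgebraicGeometry.Motives.baseChange K K').map 𝒳.genericIso.hom := rfl

/-- **Smooth of relative dimension `n` and proper are preserved by base change of models** (Mathlib: both properties
are stable under base change; [GortzWedhorn2020] Remark 16.54). [cite: SerreTate1968, §1] -/
theorem IsSmoothProper.baseChange {n : ℕ} (h : 𝒳.IsSmoothProper n) : (𝒳.baseChange R' K').IsSmoothProper n := by
  obtain ⟨hs, hp⟩ := h
  refine ⟨?_, ?_⟩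
  · haveI := smoothOfRelativeDimension_isStableUnderBaseChange (n := n)
    exact MorphismProperty.baseChange_obj _ _ hs
  · exact MorphismProperty.baseChange_obj _ _ hp

/-- The base-changed model is proper over `R′` when `𝒳` is (properness is stable under base change; [GortzWedhorn2020]
Remark 16.54, [SerreTate1968] §1). [cite: SerreTate1968, §1] -/
theorem isProper_baseChange_total [IsProper 𝒳.total.hom] : IsProper (𝒳.baseChange R' K').total.hom :=
  MorphismProperty.baseChange_obj _ _ ‹_›


/-- Geometric irreducibility of the fibres is preserved by base change of models (Mathlib:
`GeometricallyIrreducible` is stable under base change) — the hypothesis Koizumi's theorem over the cover consumes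
(irreducible special fibre). [cite: SerreTate1968, §1] -/
theorem geometricallyIrreducible_baseChange_total [GeometricallyIrreducible 𝒳.total.hom] :
    GeometricallyIrreducible (𝒳.baseChange R' K').total.hom :=
  MorphismProperty.baseChange_obj _ _ ‹_›

/-- **Projection formula for the new generic isomorphism**: on underlying schemes,
`genericIso′ ≫ pr_X = exch ≫ pr_{𝒳_K} ≫ genericIso` (naturality of the first projection along `genericIso`).
[cite: GortzWedhorn2020, Prop. 4.16 and §(4.7)] -/
@[reassoc]
theorem baseChange_genericIso_hom_left_comp_fst :
    (𝒳.baseChange R' K').genericIso.hom.left ≫ baseChangeHomFst (algebraMap K K') X =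
      ((baseChangeGenericNatIso R' K').hom.app 𝒳.total).left ≫
        baseChangeHomFst (algebraMap K K') ((baseChangeHom (algebraMap R K)).obj 𝒳.total) ≫ 𝒳.genericIso.hom.left := by
  rw [baseChange_genericIso_hom, Over.comp_left, Category.assoc,
    AbelianVariety.GoodReductionAt.baseChange_map_eq_baseChangeHom_map, baseChangeHom_map_left_comp_fst]

/-- **The generic isomorphism of `𝒳 ⊗_R R′` over the projections to `𝒳`**: composing `genericIso′` with
`pr : X ⊗_K K′ → X`, the inverse of `genericIso` and `pr : 𝒳 ⊗_R K → 𝒳` gives the double projection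
`(𝒳 ⊗_R R′) ⊗_{R′} K′ → 𝒳 ⊗_R R′ → 𝒳` — the square a descent datum for the group law is read against.
[cite: GortzWedhorn2020, Prop. 4.16 and §(4.7)] [cite: SerreTate1968, §1] -/
theorem baseChange_genericIso_hom_left_comp_fst_comp :
    (𝒳.baseChange R' K').genericIso.hom.left ≫ baseChangeHomFst (algebraMap K K') X ≫ 𝒳.genericIso.inv.left ≫
        baseChangeHomFst (algebraMap R K) 𝒳.total =
      baseChangeHomFst (algebraMap R' K') ((baseChangeHom (algebraMap R R')).obj 𝒳.total) ≫
        baseChangeHomFst (algebraMap R R') 𝒳.total := by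
  rw [baseChange_genericIso_hom_left_comp_fst_assoc, ← Over.comp_left_assoc, Iso.hom_inv_id, Over.id_left,
    Category.id_comp, baseChangeGenericNatIso_hom_app_left_comp_fst_fst]

end IntegralModel

/-! ### Abelian varieties: the base-changed model is a model of `A ⊗_K K′` -/

namespace IntegralModel

variable {R K : Type u} [CommRing R] [Field K] [Algebra R K]
  (R' K' : Type u) [CommRing R'] [Field K'] [Algebra R R'] [Algebra R' K'] [Algebra K K'] [Algebra R K']
  [IsScalarTower R R' K'] [IsScalarTower R K K'] {A : AbelianVariety K} (𝒳 : IntegralModel R K A.X)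

/-- **The base change of a model of (the variety underlying) an abelian variety `A` is a model of `A ⊗_K K′`**
(`(A.baseChange K′).X` is `(baseChange K K′).obj A.X` by `rfl`). [cite: SerreTate1968, §1] -/
def baseChangeAbelianVariety : IntegralModel R' K' (A.baseChange K').X :=
  𝒳.baseChange R' K'

/-- `baseChangeAbelianVariety` is `baseChange` (by `rfl`; only the type is re-read). [cite: SerreTate1968, §1] -/
theorem baseChangeAbelianVariety_eq : 𝒳.baseChangeAbelianVariety R' K' = 𝒳.baseChange R' K' := rfl

/-- A smooth proper model of relative dimension `dim A` base-changes to a smooth proper model of relative dimension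
`dim (A ⊗_K K′) = dim A` — the hypothesis of Koizumi's theorem over the cover. [cite: SerreTate1968, §1] -/
theorem IsSmoothProper.baseChangeAbelianVariety (h : 𝒳.IsSmoothProper A.dim) :
    (𝒳.baseChangeAbelianVariety R' K').IsSmoothProper (A.baseChange K').dim := by
  rw [AbelianVariety.dim_baseChange]
  exact h.baseChange R' K'

end IntegralModel

end Literature.AlgebraicGeometry.Motives

end
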